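import Summits.QuantumFields.YangMills.Theorems.VirialFluxGapRingDeficitDefs
import Summits.QuantumFields.YangMills.Theorems.VirialFluxGapVirialIdentity
import Summits.QuantumFields.YangMills.Theorems.LuscherReductionRunningReductionLatticeLinkKernel
import HarnessLib

/-!
# Route `VirialFluxGap` (YangMills): the DEFICIT FORM of the sector weights — stubs `stub_deficitForm` («tauber», crux 24204) and
# `stub_deficitFormZero` («tauber-mean», crux 24141) BY NAME

With the action deficit `F_z = 12L⁴ − Φ_z` of a `2L`-slice ring history (tree defs ✓`RingDeficit.ringMeasure/ringExponent/ringDeficit`,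
verbatim the «tauber» skeletons' problem-side definitions):

* `F_z` is measurable and NON-NEGATIVE: `Φ_z = Σ_{2L bonds} log K_1 ≤ 2L · 6L³ = 12L⁴`, because `log K_1(U,V) = Σ_e Re tr(U_eV_e⁻¹) −
  ½(S(U)+S(V)) ≤ 2·|E| = 6L³` (`Re tr ≤ 2` on `SU(2)` ✓`re_trace_le_two`, `S ≥ 0` ✓`wilsonAction_su2_nonneg_lat`);
* `W_z(b) = e^{12bL⁴} ∫ e^{−bF_z} dμ_L`, so `log W_z(b) = 12bL⁴ + log ∫ e^{−bF_z} dμ_L` (`deficitForm` = the Prop `DeficitForm` of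
  stub `stub_deficitForm`, verbatim);
* the VIRIAL IDENTITY in ratio form `β·(log W_z)′(β) = 12βL⁴ − β·∫F_z e^{−βF_z}dμ_L / ∫e^{−βF_z}dμ_L` for every `z` (dominated differentiation
  ✓`TT.SectorSmooth.hasDerivAt_integral_exp_mul`), in particular for `z = 0` (`deficitFormZero` = the Prop `DeficitFormZero` of stub
  `stub_deficitFormZero`, verbatim).

HONEST FRAMING: S/M stubs (bookkeeping) of evidence skeletons (DRAFT-by-design lines of planner ym-idea-4 g14); the hearts `VolumeExponent` /
`PeriodicVolumeLaw`, the cruxes 24204 / 24141 and the leaf are OPEN; no rung / summit statement is proved; the Yang–Mills mass gap is NOT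
proved.  THEOREMS ONLY (0 `def`, 0 `sorry`), standard axioms.  References: [cite: MontvayMunster1994, (3.145)]; [cite: Luscher1983, §2].
-/

set_option autoImplicit false

noncomputable section

open MeasureTheory Filter Set Function
open scoped BigOperators Topology
open Literature.MathematicalPhysics.QuantumFieldTheory hiding SU2
open Literature.MathematicalPhysics.QuantumLattice (fundamentalRep_apply)
open Summit.QuantumFields.YangMills.Theorems.FemtoTransferGap
open Summit.QuantumFields.YangMills.Theorems.FemtoTransferGap.TT
open Summit.QuantumFields.YangMills.Theorems.FemtoTransferGap.TT.SectorSmooth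

namespace Summit.QuantumFields.YangMills.Theorems.VirialFluxGap.RingDeficit

variable {L : ℕ} [NeZero L]

/-! ## §1 The exponent is at most `12L⁴`: the deficit is non-negative -/

/-- The time-like coupling is at most `2|E| = 6L³`. [folklore] -/
theorem timeCoupling_su2Rep_le (U V : GaugeConfig 3 L SU2) : timeCoupling su2Rep U V ≤ 6 * (L : ℝ) ^ 3 := by
  unfold timeCoupling
  calc ∑ e : Edge 3 L, ((su2Rep (U e * (V e)⁻¹)).trace).re ≤ ∑ _e : Edge 3 L, (2 : ℝ) :=
        Finset.sum_le_sum fun e _ => by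
          simpa only [fundamentalRep_apply] using re_trace_le_two (U e * (V e)⁻¹)
    _ = 6 * (L : ℝ) ^ 3 := by
        have hcard : Fintype.card (Edge 3 L) = 3 * L ^ 3 := by
          rw [Fintype.card_prod, Fintype.card_pi, Finset.prod_const, Finset.card_univ, Fintype.card_fin, ZMod.card]
          ring
        rw [Finset.sum_const, Finset.card_univ, hcard, nsmul_eq_mul]
        push_cast; ring

/-- `log K_1(U,V) ≤ 6L³`. [cite: Luscher1983, §2] -/
theorem log_transferKernel_one_le (U V : GaugeConfig 3 L SU2) :
    Real.log (transferKernel su2Rep 1 U V) ≤ 6 * (L : ℝ) ^ 3 := by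
  rw [log_transferKernel_one]
  have h1 := timeCoupling_su2Rep_le U V
  have h2 := wilsonAction_su2_nonneg_lat U
  have h3 := wilsonAction_su2_nonneg_lat V
  linarith

/-- The ring exponent is the sector exponent of ✓`sectorWeight_one_eq_integral_exp` at `n = 2L − 1` (definitional). [folklore] -/
theorem ringExponent_eq (z : Fin 3 → Bool) (p : (Fin (2 * L - 1 + 1) → GaugeConfig 3 L SU2) × (Site 3 L → SU2)) :
    ringExponent L z p = Real.log ((∏ i : Fin (2 * L - 1), transferKernel su2Rep 1 (p.1 i.castSucc) (p.1 i.succ)) *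
      transferKernel su2Rep 1 (p.1 (Fin.last (2 * L - 1))) (gaugeTransform p.2 (twist3 z (p.1 0)))) := rfl

/-- ★ `Φ_z ≤ 12L⁴`: `2L` bonds, each `log K_1 ≤ 6L³`. [cite: Luscher1983, §2] -/
theorem ringExponent_le (z : Fin 3 → Bool) (p : (Fin (2 * L - 1 + 1) → GaugeConfig 3 L SU2) × (Site 3 L → SU2)) :
    ringExponent L z p ≤ 12 * (L : ℝ) ^ 4 := by
  rw [ringExponent_eq, log_seamChain_one]
  have hL1 : 1 ≤ L := NeZero.one_le
  have hsum : (∑ i : Fin (2 * L - 1), Real.log (transferKernel su2Rep 1 (p.1 i.castSucc) (p.1 i.succ))) ≤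
      ((2 * L - 1 : ℕ) : ℝ) * (6 * (L : ℝ) ^ 3) := by
    calc (∑ i : Fin (2 * L - 1), Real.log (transferKernel su2Rep 1 (p.1 i.castSucc) (p.1 i.succ)))
        ≤ ∑ _i : Fin (2 * L - 1), 6 * (L : ℝ) ^ 3 := Finset.sum_le_sum fun i _ => log_transferKernel_one_le _ _
      _ = ((2 * L - 1 : ℕ) : ℝ) * (6 * (L : ℝ) ^ 3) := by
          rw [Finset.sum_const, Finset.card_univ, Fintype.card_fin, nsmul_eq_mul]
  have hseam := log_transferKernel_one_le (p.1 (Fin.last (2 * L - 1))) (gaugeTransform p.2 (twist3 z (p.1 0)))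
  have hcast : ((2 * L - 1 : ℕ) : ℝ) = 2 * (L : ℝ) - 1 := by
    rw [Nat.cast_sub (by omega), Nat.cast_mul]; norm_num
  rw [hcast] at hsum
  have hL0 : (0 : ℝ) ≤ (L : ℝ) ^ 3 := by positivity
  nlinarith

/-- The ring exponent is measurable. [folklore] -/
theorem measurable_ringExponent (z : Fin 3 → Bool) : Measurable (ringExponent L z) :=
  measurable_sectorExponent (L := L) (2 * L - 1) z

/-- The action deficit is measurable. [folklore] -/
theorem measurable_ringDeficit (z : Fin 3 → Bool) : Measurable (ringDeficit L z) :=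
  measurable_const.sub (measurable_ringExponent z)

/-- ★ The action deficit is non-negative. [cite: Luscher1983, §2] -/
theorem ringDeficit_nonneg (z : Fin 3 → Bool) (p : (Fin (2 * L - 1 + 1) → GaugeConfig 3 L SU2) × (Site 3 L → SU2)) :
    0 ≤ ringDeficit L z p := by
  unfold ringDeficit
  have := ringExponent_le z p
  linarith

/-- The action deficit is bounded. [folklore] -/
theorem exists_abs_ringDeficit_le (z : Fin 3 → Bool) : ∃ B : ℝ, ∀ p, |ringDeficit L z p| ≤ B := by
  obtain ⟨B, hB⟩ := exists_abs_sectorExponent_le (L := L) (2 * L - 1) z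
  refine ⟨12 * (L : ℝ) ^ 4 + B, fun p => ?_⟩
  unfold ringDeficit
  have h := hB p
  rw [← ringExponent_eq] at h
  have h12 : (0 : ℝ) ≤ 12 * (L : ℝ) ^ 4 := by positivity
  calc |12 * (L : ℝ) ^ 4 - ringExponent L z p| ≤ |12 * (L : ℝ) ^ 4| + |ringExponent L z p| := abs_sub _ _
    _ ≤ 12 * (L : ℝ) ^ 4 + B := add_le_add (le_of_eq (abs_of_nonneg h12)) h

/-! ## §2 The sector weight in deficit form -/

/-- `ringMeasure L` is a probability measure. [folklore] -/
theorem isProbabilityMeasure_ringMeasure : IsProbabilityMeasure (ringMeasure L) := by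
  haveI := isProbabilityMeasure_gaugeMeasure (L := L)
  unfold ringMeasure; infer_instance

/-- `e^{−bF_z}` is integrable. [folklore] -/
theorem integrable_exp_neg_mul_ringDeficit (b : ℝ) (z : Fin 3 → Bool) :
    Integrable (fun p => Real.exp (-(b * ringDeficit L z p))) (ringMeasure L) := by
  haveI := isProbabilityMeasure_ringMeasure (L := L)
  obtain ⟨B, hB⟩ := exists_abs_ringDeficit_le (L := L) z
  refine Integrable.of_bound ((measurable_const.mul (measurable_ringDeficit z)).neg.exp).aestronglyMeasurable
    (Real.exp (|b| * B)) (ae_of_all _ fun p => ?_)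
  rw [Real.norm_eq_abs, Real.abs_exp]
  refine Real.exp_le_exp.2 ?_
  have h1 : |b * ringDeficit L z p| ≤ |b| * B := by
    rw [abs_mul]; exact mul_le_mul_of_nonneg_left (hB p) (abs_nonneg _)
  have := neg_abs_le (b * ringDeficit L z p)
  linarith

/-- `F_z e^{−bF_z}` is integrable. [folklore] -/
theorem integrable_ringDeficit_mul_exp (b : ℝ) (z : Fin 3 → Bool) :
    Integrable (fun p => ringDeficit L z p * Real.exp (-(b * ringDeficit L z p))) (ringMeasure L) := by
  haveI := isProbabilityMeasure_ringMeasure (L := L)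
  obtain ⟨B, hB⟩ := exists_abs_ringDeficit_le (L := L) z
  refine Integrable.of_bound
    ((measurable_ringDeficit z).mul (measurable_const.mul (measurable_ringDeficit z)).neg.exp).aestronglyMeasurable
    (B * Real.exp (|b| * B)) (ae_of_all _ fun p => ?_)
  rw [Real.norm_eq_abs, abs_mul, Real.abs_exp]
  refine mul_le_mul (hB p) (Real.exp_le_exp.2 ?_) (Real.exp_pos _).le ((abs_nonneg _).trans (hB p))
  have h1 : |b * ringDeficit L z p| ≤ |b| * B := by
    rw [abs_mul]; exact mul_le_mul_of_nonneg_left (hB p) (abs_nonneg _)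
  have := neg_abs_le (b * ringDeficit L z p)
  linarith

/-- `∫ e^{−bF_z} dμ_L > 0`. [folklore] -/
theorem integral_exp_neg_mul_ringDeficit_pos (b : ℝ) (z : Fin 3 → Bool) :
    0 < ∫ p, Real.exp (-(b * ringDeficit L z p)) ∂(ringMeasure L) := by
  haveI := isProbabilityMeasure_ringMeasure (L := L)
  have h := integral_exp_mul_pos (ringMeasure L) (measurable_ringDeficit (L := L) z).neg
    (B := Classical.choose (exists_abs_ringDeficit_le (L := L) z))
    (fun p => by
      simp only [Pi.neg_apply, abs_neg]
      exact Classical.choose_spec (exists_abs_ringDeficit_le (L := L) z) p) b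
  refine h.trans_le (le_of_eq (integral_congr_ae (ae_of_all _ fun p => ?_)))
  simp only [Pi.neg_apply, mul_neg]

/-- ★ **Deficit form of the sector weight**: `W_z(b) = e^{12bL⁴} · ∫ e^{−bF_z} dμ_L`. [cite: MontvayMunster1994, (3.145)] -/
theorem sectorWeight_eq_exp_mul_integral_deficit (b : ℝ) (z : Fin 3 → Bool) :
    sectorWeight (L := L) b (2 * L - 1) z (fun _ _ => (1 : ℝ)) =
      Real.exp (12 * b * (L : ℝ) ^ 4) * ∫ p, Real.exp (-(b * ringDeficit L z p)) ∂(ringMeasure L) := by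
  rw [sectorWeight_one_eq_integral_exp b (2 * L - 1) z, ← integral_const_mul]
  refine integral_congr_ae (ae_of_all _ fun p => ?_)
  show Real.exp (b * ringExponent L z p) = Real.exp (12 * b * (L : ℝ) ^ 4) * Real.exp (-(b * ringDeficit L z p))
  rw [← Real.exp_add]
  congr 1
  unfold ringDeficit
  ring

/-- ★ `log W_z(b) = 12bL⁴ + log ∫ e^{−bF_z} dμ_L`. [cite: MontvayMunster1994, (3.145)] -/
theorem log_sectorWeight_eq (b : ℝ) (z : Fin 3 → Bool) :
    Real.log (sectorWeight (L := L) b (2 * L - 1) z (fun _ _ => (1 : ℝ))) =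
      12 * b * (L : ℝ) ^ 4 + Real.log (∫ p, Real.exp (-(b * ringDeficit L z p)) ∂(ringMeasure L)) := by
  rw [sectorWeight_eq_exp_mul_integral_deficit, Real.log_mul (Real.exp_pos _).ne' (integral_exp_neg_mul_ringDeficit_pos b z).ne',
    Real.log_exp]

/-- ★★ **`DeficitForm`** (the Prop of stub `stub_deficitForm` of LINE «tauber» on crux stmt-QuantumFields-24204, verbatim against the tree
defs `RingDeficit.ringMeasure/ringDeficit`): measurability and non-negativity of `F_z`, and `log W_z(b) = 12bL⁴ + log ∫e^{−bF_z}dμ_L`.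
No crux / rung / summit is proved; the YM mass gap is NOT proved. [cite: MontvayMunster1994, (3.145)] [cite: Luscher1983, §2] -/
theorem deficitForm :
    ∀ (L : ℕ) [NeZero L] (z : Fin 3 → Bool),
      Measurable (ringDeficit L z) ∧ (∀ p, 0 ≤ ringDeficit L z p) ∧
      ∀ b : ℝ, Real.log (TT.sectorWeight (L := L) b (2 * L - 1) z (fun _ _ => (1 : ℝ))) =
        12 * b * (L : ℝ) ^ 4 + Real.log (∫ p, Real.exp (-(b * ringDeficit L z p)) ∂(ringMeasure L)) :=
  fun _ _ z => ⟨measurable_ringDeficit z, ringDeficit_nonneg z, fun b => log_sectorWeight_eq b z⟩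

/-! ## §3 The virial identity in ratio form -/

/-- The sector weight has derivative `∫ Φ_z e^{bΦ_z} dμ_L` in the coupling. [cite: MontvayMunster1994, (3.145)] -/
theorem hasDerivAt_sectorWeight_ringExponent (b : ℝ) (z : Fin 3 → Bool) :
    HasDerivAt (fun b' : ℝ => sectorWeight (L := L) b' (2 * L - 1) z (fun _ _ => (1 : ℝ)))
      (∫ p, ringExponent L z p * Real.exp (b * ringExponent L z p) ∂(ringMeasure L)) b := by
  haveI := isProbabilityMeasure_ringMeasure (L := L)
  obtain ⟨B, hB⟩ := exists_abs_sectorExponent_le (L := L) (2 * L - 1) z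
  have hder := hasDerivAt_integral_exp_mul (ringMeasure L) (measurable_ringExponent (L := L) z) (B := B)
    (fun p => by rw [ringExponent_eq]; exact hB p) b
  have hfun : (fun b' : ℝ => sectorWeight (L := L) b' (2 * L - 1) z (fun _ _ => (1 : ℝ))) =
      fun b' : ℝ => ∫ p, Real.exp (b' * ringExponent L z p) ∂(ringMeasure L) :=
    funext fun b' => sectorWeight_one_eq_integral_exp b' (2 * L - 1) z
  rw [hfun]
  exact hder

/-- `∫ Φ_z e^{bΦ_z} = e^{12bL⁴}·(12L⁴ ∫e^{−bF_z} − ∫ F_z e^{−bF_z})`. [folklore] -/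
theorem integral_ringExponent_mul_exp (b : ℝ) (z : Fin 3 → Bool) :
    ∫ p, ringExponent L z p * Real.exp (b * ringExponent L z p) ∂(ringMeasure L) =
      Real.exp (12 * b * (L : ℝ) ^ 4) * (12 * (L : ℝ) ^ 4 * ∫ p, Real.exp (-(b * ringDeficit L z p)) ∂(ringMeasure L) -
        ∫ p, ringDeficit L z p * Real.exp (-(b * ringDeficit L z p)) ∂(ringMeasure L)) := by
  have hpt : ∀ p, ringExponent L z p * Real.exp (b * ringExponent L z p) =
      Real.exp (12 * b * (L : ℝ) ^ 4) * (12 * (L : ℝ) ^ 4 * Real.exp (-(b * ringDeficit L z p))) -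
        Real.exp (12 * b * (L : ℝ) ^ 4) * (ringDeficit L z p * Real.exp (-(b * ringDeficit L z p))) := by
    intro p
    have hΦ : ringExponent L z p = 12 * (L : ℝ) ^ 4 - ringDeficit L z p := by unfold ringDeficit; ring
    have hexp : Real.exp (b * ringExponent L z p) = Real.exp (12 * b * (L : ℝ) ^ 4) * Real.exp (-(b * ringDeficit L z p)) := by
      rw [← Real.exp_add]; congr 1; rw [hΦ]; ring
    rw [hexp, hΦ]; ring
  simp_rw [hpt]
  rw [integral_sub ((integrable_exp_neg_mul_ringDeficit b z).const_mul _ |>.const_mul _)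
    ((integrable_ringDeficit_mul_exp b z).const_mul _), integral_const_mul, integral_const_mul, integral_const_mul]
  ring

/-- ★ **Virial identity in ratio form**, every sector: `β·(log W_z)′(β) = 12βL⁴ − β·∫F_z e^{−βF_z}dμ_L / ∫e^{−βF_z}dμ_L`.
[cite: MontvayMunster1994, (3.145)] -/
theorem mul_deriv_log_sectorWeight_eq (β : ℝ) (z : Fin 3 → Bool) :
    β * deriv (fun b : ℝ => Real.log (TT.sectorWeight (L := L) b (2 * L - 1) z (fun _ _ => (1 : ℝ)))) β =
      12 * β * (L : ℝ) ^ 4 -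
        β * (∫ p, ringDeficit L z p * Real.exp (-(β * ringDeficit L z p)) ∂(ringMeasure L)) /
          (∫ p, Real.exp (-(β * ringDeficit L z p)) ∂(ringMeasure L)) := by
  have hW := hasDerivAt_sectorWeight_ringExponent (L := L) β z
  have hWpos := sectorWeight_one_pos (L := L) β (2 * L - 1) z
  have hlog := hW.log hWpos.ne'
  rw [hlog.deriv, integral_ringExponent_mul_exp, sectorWeight_eq_exp_mul_integral_deficit]
  have hI := (integral_exp_neg_mul_ringDeficit_pos (L := L) β z).ne'
  have hE := (Real.exp_pos (12 * β * (L : ℝ) ^ 4)).ne'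
  field_simp

/-- ★★ **`DeficitFormZero`** (the Prop of stub `stub_deficitFormZero` of LINE «tauber-mean» on the deciding crux stmt-QuantumFields-24141,
verbatim against the tree defs): measurability and non-negativity of the zero-flux deficit `F₀`, and the virial identity in ratio form
`β·(log W₀)′(β) = 12βL⁴ − β·∫F₀e^{−βF₀}dμ_L / ∫e^{−βF₀}dμ_L` for `β > 0`.  No crux / rung / summit is proved; the YM mass gap is NOT proved.
[cite: MontvayMunster1994, (3.145)] [cite: Luscher1983, §2] -/
theorem deficitFormZero :
    ∀ (L : ℕ) [NeZero L],
      Measurable (ringDeficit L (fun _ => false)) ∧ (∀ p, 0 ≤ ringDeficit L (fun _ => false) p) ∧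
      ∀ β : ℝ, 0 < β →
        β * deriv (fun b : ℝ => Real.log (TT.sectorWeight (L := L) b (2 * L - 1) (fun _ => false) (fun _ _ => (1 : ℝ)))) β =
          12 * β * (L : ℝ) ^ 4 -
            β * (∫ p, ringDeficit L (fun _ => false) p * Real.exp (-(β * ringDeficit L (fun _ => false) p)) ∂(ringMeasure L)) /
              (∫ p, Real.exp (-(β * ringDeficit L (fun _ => false) p)) ∂(ringMeasure L)) :=
  fun _ _ => ⟨measurable_ringDeficit _, ringDeficit_nonneg _, fun β _ => mul_deriv_log_sectorWeight_eq β _⟩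

end Summit.QuantumFields.YangMills.Theorems.VirialFluxGap.RingDeficit

end
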